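import Mathlib
import HarnessLib

/-!
# Turán quadratic forms of a three-term recurrence: elementary estimates

Measure-free lemmas behind the Máté–Nevai / Dombrowski–Nevai "Turán determinant" method for
orthogonal polynomials with recurrence coefficients of bounded variation (A. Máté, P. Nevai,
*Orthogonal polynomials and absolutely continuous measures*, Approximation Theory IV (1983),
611–617; J. Dombrowski, P. Nevai, *Orthogonal polynomials, measures and recurrence relations*,
SIAM J. Math. Anal. 17 (1986) 752–759, proof of Thm 1). For a scalar recurrence
`x u₁ = A₁ u₂ + A₀ u₀` the Turán quadratic forms are `T₀ = u₁² - (x/A₀) u₁ u₀ + u₀²`,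
`T₁ = u₂² - (x/A₁) u₂ u₁ + u₁²`; everything is stated for real numbers / real sequences, with the
forms passed as variables `T₀, T₁` together with their defining equations (no definitions).

* `TuranForm.quadForm_lower`: ellipticity `(1 - ρ)(a² + b²) ≤ a² - c a b + b²` for `|c| ≤ 2ρ`;
* `TuranForm.step_identity`: `T₁ - T₀ = u₂ u₀ (A₁ - A₀)(1/A₀ + 1/A₁)`;
* `TuranForm.step_abs_le`: `|T₁ - T₀| (1 - ρ) a ≤ |A₁ - A₀| (T₁ + T₀)` when `0 < a ≤ A₀, A₁` and
  `|x/Aᵢ| ≤ 2ρ`, `ρ ≤ 1`;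
* `TuranForm.ratio_bounds_of_abs_sub_le`, `TuranForm.two_sided_gronwall`: a two-sided discrete
  Grönwall lemma (`|t - s| ≤ ε (t + s)` gives `t ≤ (1 + 4ε) s`, `s ≤ (1 + 4ε) t`; telescoping
  against `exp (∑ e)`);
* `TuranForm.sq_add_sq_pos_of_recurrence`: two consecutive terms of the recurrence never vanish
  together when `u 0 ≠ 0`;
* `TuranForm.tendstoUniformlyOn_limUnder_of_dist_succ_le`: uniform convergence (to the pointwise
  `limUnder`) from summable uniform increments;
* `TuranForm.continuousOn_Ioo_of_tendstoUniformlyOn_Icc`: a uniform limit on every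
  `[-1+δ, 1-δ]` of continuous functions is continuous on `(-1, 1)`.

Used by `Summits/AtomisticToContinuum/FouriersLaw/Theorems/…GreenKuboContinuationMnTuran.lean`
(the Turán-determinant limit `stub_mnTuran`). Mathlib (v4.32) has the ingredients
(`cauchySeq_of_dist_le_of_summable`, `dist_le_tsum_of_dist_le_of_tendsto`, `tendsto_sum_nat_add`,
`TendstoUniformlyOn.continuousOn`, `Real.add_one_le_exp`) but none of these packaged statements.
Deliberately NOT here: orthogonality, measures, the limit density formula.
-/

noncomputable section

open Filter Topology Set

namespace Literature.Analysis.Approximation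

namespace TuranForm

/-- Ellipticity of the Turán quadratic form, lower bound: if `|c| ≤ 2ρ` then
`(1 - ρ)(a² + b²) ≤ a² - c a b + b²`. [folklore] -/
theorem quadForm_lower {a b c ρ : ℝ} (hc : |c| ≤ 2 * ρ) :
    (1 - ρ) * (a ^ 2 + b ^ 2) ≤ a ^ 2 - c * a * b + b ^ 2 := by
  have h1 : c * a * b ≤ |c| * |a * b| := by
    rw [mul_assoc, ← abs_mul]
    exact le_abs_self _
  have h2 : 2 * |a * b| ≤ a ^ 2 + b ^ 2 := by
    rw [abs_mul]
    linarith [two_mul_le_add_sq |a| |b|, sq_abs a, sq_abs b]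
  have h3 : |c| * |a * b| ≤ 2 * ρ * |a * b| := mul_le_mul_of_nonneg_right hc (abs_nonneg _)
  have hρ : 0 ≤ ρ := by linarith [abs_nonneg c]
  have h4 : ρ * (2 * |a * b|) ≤ ρ * (a ^ 2 + b ^ 2) := mul_le_mul_of_nonneg_left h2 hρ
  nlinarith

/-- The one-step identity for the Turán forms along the scalar recurrence
`x u₁ = A₁ u₂ + A₀ u₀`: with `T₀ = u₁² - (x/A₀) u₁ u₀ + u₀²` and `T₁ = u₂² - (x/A₁) u₂ u₁ + u₁²`,
`T₁ - T₀ = u₂ u₀ (A₁ - A₀) (1/A₀ + 1/A₁)`. [folklore] -/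
theorem step_identity {x u0 u1 u2 A0 A1 T0 T1 : ℝ} (hA0 : A0 ≠ 0) (hA1 : A1 ≠ 0)
    (h : x * u1 = A1 * u2 + A0 * u0)
    (hT0 : T0 = u1 ^ 2 - x / A0 * u1 * u0 + u0 ^ 2)
    (hT1 : T1 = u2 ^ 2 - x / A1 * u2 * u1 + u1 ^ 2) :
    T1 - T0 = u2 * u0 * (A1 - A0) * (1 / A0 + 1 / A1) := by
  have e0 : x / A0 * u1 * u0 = (A1 * u2 + A0 * u0) * u0 / A0 := by
    rw [← h]; field_simp
  have e1 : x / A1 * u2 * u1 = (A1 * u2 + A0 * u0) * u2 / A1 := by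
    rw [← h]; field_simp
  rw [hT0, hT1, e0, e1]
  field_simp
  ring

/-- The one-step inequality: if `0 < a ≤ A₀, A₁`, `ρ ≤ 1`, `|x/A₀|, |x/A₁| ≤ 2ρ` and
`x u₁ = A₁ u₂ + A₀ u₀`, then `|T₁ - T₀| (1 - ρ) a ≤ |A₁ - A₀| (T₁ + T₀)`. [folklore] -/
theorem step_abs_le {x u0 u1 u2 A0 A1 T0 T1 ρ a : ℝ} (ha : 0 < a) (hA0 : a ≤ A0)
    (hA1 : a ≤ A1) (hρ : ρ ≤ 1) (hx0 : |x / A0| ≤ 2 * ρ) (hx1 : |x / A1| ≤ 2 * ρ)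
    (h : x * u1 = A1 * u2 + A0 * u0)
    (hT0 : T0 = u1 ^ 2 - x / A0 * u1 * u0 + u0 ^ 2)
    (hT1 : T1 = u2 ^ 2 - x / A1 * u2 * u1 + u1 ^ 2) :
    |T1 - T0| * ((1 - ρ) * a) ≤ |A1 - A0| * (T1 + T0) := by
  have hA0p : 0 < A0 := ha.trans_le hA0
  have hA1p : 0 < A1 := ha.trans_le hA1
  have hl0 : (1 - ρ) * (u1 ^ 2 + u0 ^ 2) ≤ T0 := hT0 ▸ quadForm_lower hx0
  have hl1 : (1 - ρ) * (u2 ^ 2 + u1 ^ 2) ≤ T1 := hT1 ▸ quadForm_lower hx1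
  have hid := step_identity hA0p.ne' hA1p.ne' h hT0 hT1
  have hinv : 0 < 1 / A0 + 1 / A1 := by positivity
  rw [hid, abs_mul, abs_mul, abs_of_pos hinv]
  have h2 : 2 * |u2 * u0| ≤ u2 ^ 2 + u0 ^ 2 := by
    rw [abs_mul]
    linarith [two_mul_le_add_sq |u2| |u0|, sq_abs u2, sq_abs u0]
  have h3 : a * (1 / A0 + 1 / A1) ≤ 2 := by
    rw [mul_add, mul_one_div, mul_one_div]
    have := div_le_one_of_le₀ hA0 hA0p.le
    have := div_le_one_of_le₀ hA1 hA1p.le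
    linarith
  have h1ρ : 0 ≤ 1 - ρ := by linarith
  have hu1 : 0 ≤ (1 - ρ) * u1 ^ 2 := by positivity
  have h4 : (1 - ρ) * (2 * |u2 * u0|) ≤ T1 + T0 := by
    have := mul_le_mul_of_nonneg_left h2 h1ρ
    nlinarith
  have h5 : 0 ≤ (1 - ρ) * |u2 * u0| * |A1 - A0| := by positivity
  calc |u2 * u0| * |A1 - A0| * (1 / A0 + 1 / A1) * ((1 - ρ) * a)
        = (1 - ρ) * |u2 * u0| * |A1 - A0| * (a * (1 / A0 + 1 / A1)) := by ring
    _ ≤ (1 - ρ) * |u2 * u0| * |A1 - A0| * 2 := mul_le_mul_of_nonneg_left h3 h5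
    _ = (1 - ρ) * (2 * |u2 * u0|) * |A1 - A0| := by ring
    _ ≤ (T1 + T0) * |A1 - A0| := mul_le_mul_of_nonneg_right h4 (abs_nonneg _)
    _ = |A1 - A0| * (T1 + T0) := by ring

/-- From `|t - s| ≤ ε (t + s)` with `0 ≤ ε ≤ 1/2` and `s, t ≥ 0`: `t ≤ (1 + 4ε) s` and
`s ≤ (1 + 4ε) t`. [folklore] -/
theorem ratio_bounds_of_abs_sub_le {s t ε : ℝ} (hs : 0 ≤ s) (ht : 0 ≤ t) (hε0 : 0 ≤ ε)
    (hε : ε ≤ 1 / 2) (h : |t - s| ≤ ε * (t + s)) :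
    t ≤ (1 + 4 * ε) * s ∧ s ≤ (1 + 4 * ε) * t := by
  obtain ⟨h1, h2⟩ := abs_le.1 h
  have hε1 : 0 < 1 - ε := by linarith
  constructor
  · have k1 : (1 - ε) * t ≤ (1 + ε) * s := by linarith
    have k2 : (1 + ε) * s ≤ (1 - ε) * ((1 + 4 * ε) * s) := by
      nlinarith [mul_nonneg (mul_nonneg hε0 hs) (sub_nonneg.2 hε)]
    exact le_of_mul_le_mul_left (k1.trans k2) hε1
  · have k1 : (1 - ε) * s ≤ (1 + ε) * t := by linarith
    have k2 : (1 + ε) * t ≤ (1 - ε) * ((1 + 4 * ε) * t) := by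
      nlinarith [mul_nonneg (mul_nonneg hε0 ht) (sub_nonneg.2 hε)]
    exact le_of_mul_le_mul_left (k1.trans k2) hε1

/-- Two-sided discrete Grönwall lemma: if `t ≥ 0` and, for `n ≥ N`, `t (n+1) ≤ (1 + e n) t n` and
`t n ≤ (1 + e n) t (n+1)` with `e ≥ 0` summable, then `t n` and `t N` are comparable up to the
factor `exp (∑ e)` for all `n ≥ N`. [folklore] -/
theorem two_sided_gronwall (t e : ℕ → ℝ) (N : ℕ) (he : ∀ n, 0 ≤ e n) (hes : Summable e)
    (ht : ∀ n, N ≤ n → 0 ≤ t n)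
    (hup : ∀ n, N ≤ n → t (n + 1) ≤ (1 + e n) * t n)
    (hdn : ∀ n, N ≤ n → t n ≤ (1 + e n) * t (n + 1)) :
    ∀ n, N ≤ n →
      t n ≤ Real.exp (∑' k, e k) * t N ∧ t N ≤ Real.exp (∑' k, e k) * t n := by
  -- sharper statement with the partial sums over `Ico N n`
  have key : ∀ n, N ≤ n →
      t n ≤ Real.exp (∑ k ∈ Finset.Ico N n, e k) * t N ∧
        t N ≤ Real.exp (∑ k ∈ Finset.Ico N n, e k) * t n := by
    intro n hn
    induction n, hn using Nat.le_induction with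
    | base => simp
    | succ n hn ih =>
      obtain ⟨ih1, ih2⟩ := ih
      have hsum : ∑ k ∈ Finset.Ico N (n + 1), e k = (∑ k ∈ Finset.Ico N n, e k) + e n :=
        Finset.sum_Ico_succ_top hn e
      have hexp : 1 + e n ≤ Real.exp (e n) := by
        have := Real.add_one_le_exp (e n); linarith
      have htn := ht n hn
      have htn1 := ht (n + 1) (Nat.le_succ_of_le hn)
      have hE0 : 0 ≤ Real.exp (∑ k ∈ Finset.Ico N n, e k) := (Real.exp_pos _).le
      rw [hsum, Real.exp_add]
      constructor
      · calc t (n + 1) ≤ (1 + e n) * t n := hup n hn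
          _ ≤ Real.exp (e n) * t n := mul_le_mul_of_nonneg_right hexp htn
          _ ≤ Real.exp (e n) * (Real.exp (∑ k ∈ Finset.Ico N n, e k) * t N) :=
              mul_le_mul_of_nonneg_left ih1 (Real.exp_pos _).le
          _ = Real.exp (∑ k ∈ Finset.Ico N n, e k) * Real.exp (e n) * t N := by ring
      · calc t N ≤ Real.exp (∑ k ∈ Finset.Ico N n, e k) * t n := ih2
          _ ≤ Real.exp (∑ k ∈ Finset.Ico N n, e k) * ((1 + e n) * t (n + 1)) :=
              mul_le_mul_of_nonneg_left (hdn n hn) hE0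
          _ ≤ Real.exp (∑ k ∈ Finset.Ico N n, e k) * (Real.exp (e n) * t (n + 1)) :=
              mul_le_mul_of_nonneg_left (mul_le_mul_of_nonneg_right hexp htn1) hE0
          _ = Real.exp (∑ k ∈ Finset.Ico N n, e k) * Real.exp (e n) * t (n + 1) := by ring
  intro n hn
  obtain ⟨k1, k2⟩ := key n hn
  have hle : ∑ k ∈ Finset.Ico N n, e k ≤ ∑' k, e k :=
    hes.sum_le_tsum (Finset.Ico N n) (fun k _ => he k)
  have hexp : Real.exp (∑ k ∈ Finset.Ico N n, e k) ≤ Real.exp (∑' k, e k) :=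
    Real.exp_le_exp.2 hle
  exact ⟨k1.trans (mul_le_mul_of_nonneg_right hexp (ht N le_rfl)),
    k2.trans (mul_le_mul_of_nonneg_right hexp (ht n hn))⟩

/-- Along the scalar recurrence `x u (n+1) = A (n+1) u (n+2) + A n u n` with `A n ≠ 0` and
`u 0 ≠ 0`, two consecutive terms never vanish simultaneously: `0 < u (m+1)² + u m²`. [folklore] -/
theorem sq_add_sq_pos_of_recurrence (u A : ℕ → ℝ) (x : ℝ) (hA : ∀ n, A n ≠ 0) (hu0 : u 0 ≠ 0)
    (hrec : ∀ n, x * u (n + 1) = A (n + 1) * u (n + 2) + A n * u n) (m : ℕ) :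
    0 < u (m + 1) ^ 2 + u m ^ 2 := by
  have key : ∀ m, ¬ (u (m + 1) = 0 ∧ u m = 0) := by
    intro m
    induction m with
    | zero => exact fun h => hu0 h.2
    | succ m ih =>
      rintro ⟨h2, h1⟩
      apply ih
      refine ⟨h1, ?_⟩
      have := hrec m
      rw [h1, h2, mul_zero, mul_zero, zero_add] at this
      exact (mul_eq_zero.1 this.symm).resolve_left (hA m)
  by_cases h1 : u (m + 1) = 0
  · have h0 : u m ≠ 0 := fun h0 => key m ⟨h1, h0⟩
    have := sq_pos_iff.mpr h0
    nlinarith [sq_nonneg (u (m + 1))]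
  · have := sq_pos_iff.mpr h1
    nlinarith [sq_nonneg (u m)]

/-- Uniform convergence from summable uniform increments: if `dist (F n x) (F (n+1) x) ≤ η n` for
all `n ≥ N` and `x ∈ K` with `η` summable, then `F n → (x ↦ lim F n x)` uniformly on `K`.
[folklore] -/
theorem tendstoUniformlyOn_limUnder_of_dist_succ_le (F : ℕ → ℝ → ℝ) (K : Set ℝ) (η : ℕ → ℝ)
    (N : ℕ) (hη : Summable η)
    (h : ∀ n, N ≤ n → ∀ x ∈ K, dist (F n x) (F (n + 1) x) ≤ η n) :
    TendstoUniformlyOn F (fun x => limUnder atTop (fun n => F n x)) atTop K := by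
  -- shifted data
  set d : ℕ → ℝ := fun n => η (n + N) with hd_def
  have hd : Summable d := (summable_nat_add_iff N).2 hη
  have hconv : ∀ x ∈ K, Tendsto (fun n => F n x) atTop (𝓝 (limUnder atTop (fun n => F n x))) ∧
      ∀ n, dist (F (n + N) x) (limUnder atTop (fun n => F n x)) ≤ ∑' m, d (n + m) := by
    intro x hx
    have hstep : ∀ n, dist (F (n + N) x) (F (n.succ + N) x) ≤ d n := fun n => by
      rw [Nat.succ_add]
      exact h (n + N) (Nat.le_add_left N n) x hx
    have hcs : CauchySeq (fun n => F (n + N) x) := cauchySeq_of_dist_le_of_summable d hstep hd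
    have hlim := hcs.tendsto_limUnder
    set L := limUnder atTop (fun n => F (n + N) x)
    have hlim' : Tendsto (fun n => F n x) atTop (𝓝 L) := (tendsto_add_atTop_iff_nat N).1 hlim
    have hLeq : limUnder atTop (fun n => F n x) = L := hlim'.limUnder_eq
    rw [hLeq]
    exact ⟨hlim', fun n => dist_le_tsum_of_dist_le_of_tendsto d hstep hd hlim n⟩
  -- the tails of `d` tend to zero
  have htail : Tendsto (fun i => ∑' m, d (i + m)) atTop (𝓝 0) := by
    have := tendsto_sum_nat_add d
    refine this.congr fun i => ?_
    exact tsum_congr fun m => by rw [add_comm]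
  rw [Metric.tendstoUniformlyOn_iff]
  intro ε hε
  have hev := (htail.eventually (eventually_lt_nhds hε))
  obtain ⟨n₀, hn₀⟩ := eventually_atTop.1 hev
  refine eventually_atTop.2 ⟨n₀ + N, fun n hn x hx => ?_⟩
  obtain ⟨k, rfl⟩ := Nat.exists_eq_add_of_le' hn
  obtain ⟨-, hrate⟩ := hconv x hx
  have hk : dist (F (k + n₀ + N) x) (limUnder atTop (fun n => F n x)) ≤ ∑' m, d (k + n₀ + m) :=
    hrate (k + n₀)
  have hlt : ∑' m, d (k + n₀ + m) < ε := hn₀ (k + n₀) (Nat.le_add_left n₀ k)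
  rw [dist_comm, show k + (n₀ + N) = k + n₀ + N from (add_assoc _ _ _).symm]
  exact hk.trans_lt hlt

/-- A function which is, on every `[-1+δ, 1-δ]` (`δ > 0`), a uniform limit along `atTop` of
functions continuous on that set is continuous on `(-1, 1)`. [folklore] -/
theorem continuousOn_Ioo_of_tendstoUniformlyOn_Icc (F : ℕ → ℝ → ℝ) (S : ℝ → ℝ)
    (hF : ∀ n, Continuous (F n))
    (hS : ∀ δ : ℝ, 0 < δ → TendstoUniformlyOn F S atTop (Set.Icc (-1 + δ) (1 - δ))) :
    ContinuousOn S (Set.Ioo (-1) 1) := by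
  intro x hx
  set δ : ℝ := min (x + 1) (1 - x) / 2 with hδ_def
  have hδ : 0 < δ := by
    have h1 : 0 < x + 1 := by linarith [hx.1]
    have h2 : 0 < 1 - x := by linarith [hx.2]
    positivity
  have hcont : ContinuousOn S (Set.Icc (-1 + δ) (1 - δ)) :=
    (hS δ hδ).continuousOn (Frequently.of_forall fun n => (hF n).continuousOn)
  have hmem : Set.Icc (-1 + δ) (1 - δ) ∈ 𝓝 x := by
    apply Icc_mem_nhds
    · have : δ < x + 1 := by
        have := min_le_left (x + 1) (1 - x)
        linarith [hx.1]
      linarith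
    · have : δ < 1 - x := by
        have := min_le_right (x + 1) (1 - x)
        linarith [hx.2]
      linarith
  exact (hcont.continuousAt hmem).continuousWithinAt

end TuranForm

end Literature.Analysis.Approximation

end
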